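import Summits.QuantumFields.BalabanUV.Beta.FP.AdmissibleCubicGerm
import Summits.QuantumFields.BalabanUV.Beta.FP.PerfectHessianColumnMoments
import Summits.QuantumFields.BalabanUV.Beta.FP.PerfectHessianColumnCovariance
import Summits.QuantumFields.BalabanUV.Beta.FP.SliceCubicGerm

/-!
# `BalabanUV.Beta.FP.PerfectVertexGermSocket` — road «FP» for binder row D1, ROW H2V-4 (S-SOCKET) (owner memo `H2V-DESIGN.md` §2, `H2V4-STATEMENT.md`,
# R-FP-23; the owner's technique of record — invariant theory): THE JUNCTION END's GERM LETTER `hgermV : cubicGermOf V = cQ • bfGerm` FOR THE GLUON DATA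
# `V := S + sliceA 3` FOLLOWS FROM THE ADMISSIBLE S-SIDE LETTERS OF `S` AGAINST THE PERFECT HESSIAN `Δ_∞` WITH WARD CONSTANT `c = 1` — the Hessian-side
# letters being THEOREMS (gen 9, rows H2V-4 (N)+(R)) and the slice germ EXPLICIT (H2V-2)

HONEST DEPENDENCY (page 1, mandatory): continuum YM on T⁴ ⇐ BetaPertH ∧ nine spine estimates (0/9 proved); BetaPertH ⇐ (D1) ∧ (D4) ∧ CAP+tail;
G-an2-4 gates asym, D1 and NE2/3/4.  HONEST FRAMING (cell contract, verbatim): «discharging `BetaPertH` makes Bałaban's UV stability UNCONDITIONAL —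
a real constructive-QFT result; it is NOT the continuum limit and NOT the Clay problem.»  THIS MODULE DISCHARGES NOTHING of the wall: it is WIRING BY NAME
over `AdmissibleCubicGerm.cubicGermOf_eq_smul_ymGerm_of_admissible`∕`cubicGermOf_add` (gan24-leaf-01-g49, row H2V-1), this lineage's
`PerfectHessianColumnMoments.admissible_column_letters_deltaZLim` + `PerfectHessianColumnCovariance.admissible_symmetry_letters_deltaZLim` (gen 9, rows
H2V-4 (N)+(R)) and `SliceCubicGerm.cubicGermOf_sliceA` + `SliceVertex.locStencil_sliceA` (H2V-2).  The S-SIDE letters of the perfect cubic jet `S` — (a1)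
`LocStencil`, (a2) translation covariance, (a4) the tree Ward law against `Δ_∞` with constant `c`, (a6) Bose (first moments of the exchange defect vanish) —
are DISPLAYED HYPOTHESES (rows H2V-4′-a∕b∕c; the object `S` = the ff row of the literal's first-order tables, N0b-S).  No `def`, no `def … : Prop`, nothing
cited, 0 sorry; 0∕4 row-D1 binders; NOT H2V-4 (the S-side letters), NOT hgerm for the literal, NOT (ASYMP), NOT D1, NOT BetaPertH, NOT continuum, NOT Clay.
«not in print; our bookkeeping».

ABSOLUTE RULE (cell charter, verbatim): «No internally-minted statement may enter as a cited fact. Every hypothesis is either kernel-proved in this package or a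
verbatim quotation of a PUBLISHED theorem with page reference. The manuscript(s) under audit are NOT citable for their own disputed steps — they are the thing
under adjudication; programme-internal (2001/route/tribunal) claims are never citable.»

WHY.  The (ASYMP) END of record (`FineSplitJunctionLedger.hasym_PiBF_vertex2OfK_of_far_nearPieces` ∕ this lineage's `FineHessianNearLedger.hasym_PiBF_vertex2OfK_of_sliceLedger`)
displays `hgermV : cubicGermOf V = cQ • bfGerm` for the gluon vertex data `V` of `PiBF` and feeds `cQ` into the colour equation `hn`.  `H2V-DESIGN.md` §1 takes
`V := S + sliceA 3` (action jet + BF slice jet).  Invariant theory (row H2V-1): the admissible letters of `S` against a Hessian block `M` fix `cubicGermOf S = cQ·ymGerm`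
with `cQ = c·(−½ Σ'_x M x 0 (inl 0)(inl 0)·x₁²)`; at `M_ff = Δ_∞` that number is `c` (gen 9); the slice adds `sliceGerm`; and `bfGerm = ymGerm + sliceGerm` by definition.
So `cubicGermOf (S + sliceA 3) = c·ymGerm + sliceGerm` — which has the END's shape `cQ • bfGerm` EXACTLY WHEN `c = 1` (located: for `c ≠ 1` the total germ is NOT a
multiple of `bfGerm`; the END's socket presumes the Ward constant of the perfect action's cubic jet against its own Hessian is `1`, i.e. the canonical normalisation
of the gauge action on the background — H2V-4′-c's statement).

WHAT.  §1 [our object] **`cubicGermOf_add_sliceA_of_admissible_deltaZLim`**: S-side letters of `S` against `M` (`c` free) + `M`'s ff block `= Δ_∞`, other blocks `0`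
⟹ `cubicGermOf (S + sliceA 3) μ ν λ κ i = c·ymGerm μ ν λ κ i + sliceGerm μ ν λ κ i`; §2 [our object] **`hgermV_of_admissible_deltaZLim`**: at `c = 1`,
`cubicGermOf (S + sliceA 3) = (1 : ℝ) • bfGerm` — the END's `hgermV` with `cQ = 1` (and then `hn` reads `(40·wg·¼·c4² − wgh·(−½)·c4²)∕3 = kappaBal N`).
Provenance: road FP OWNER b2b-balaban-beta-d1-p3 gen 10 (prover-b2b-balaban-beta-d1-p3-g10-0), 2026-08-21, row H2V-4 S-socket.
-/

noncomputable section

namespace Summit.QuantumFields.BalabanUV.Beta.FP.PerfectVertexGermSocket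

open Finset
open scoped BigOperators
open Literature.MathematicalPhysics.QuantumFieldTheory.Balaban1983to89
open Literature.MathematicalPhysics.QuantumFieldTheory.Balaban1983to89.Beta
open ExpKernelCalculus (Site MKer Decays shiftK)
open OneStepResolventKernel (Fib LocStencil)
open KernelWard (divV)
open PolarizationSign (reflSign)
open Summit.QuantumFields.BalabanUV.Beta.GAN24.DirichletExhaustionDeltaZ (kappaZ kappaZ_pos)
open Summit.QuantumFields.BalabanUV.Beta.GAN24.EffectiveLaplacianLimit (deltaZLim)
open Summit.QuantumFields.BalabanUV.Beta.FP.MarginalUniqueness (Idx ymGerm rs)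
open Summit.QuantumFields.BalabanUV.Beta.FP.BubbleGermValue (sliceGerm bfGerm)
open Summit.QuantumFields.BalabanUV.Beta.FP.WilsonCubicGerm (cubicGermOf)
open Summit.QuantumFields.BalabanUV.Beta.FP.SliceVertex (sliceA locStencil_sliceA)
open Summit.QuantumFields.BalabanUV.Beta.FP.SliceCubicGerm (cubicGermOf_sliceA)
open Summit.QuantumFields.BalabanUV.Beta.FP.AdmissibleCubicGerm (cubicGermOf_eq_smul_ymGerm_of_admissible cubicGermOf_add)
open Summit.QuantumFields.BalabanUV.Beta.FP.PerfectHessianColumnMoments (admissible_column_letters_deltaZLim)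
open Summit.QuantumFields.BalabanUV.Beta.FP.PerfectHessianColumnCovariance (admissible_symmetry_letters_deltaZLim)

variable {S : Fin 4 → Site 4 → MKer 4 (Fib 3)} {Cs δ c : ℝ} {M : MKer 4 (Fib 3)}
    (hS : LocStencil S Cs δ) (hδ : 0 < δ)
    (hcov : ∀ (lam : Fin 4) (v : Site 4), S lam v = shiftK (-v) (S lam 0))
    (hlaw : ∀ (x z : Site 4) (μ ν : Fin 4), divV S 0 x z (Sum.inl μ) (Sum.inl ν) =
      c * M x z (Sum.inl μ) (Sum.inl ν) * ((if z = 0 then (1 : ℝ) else 0) - (if x = 0 then (1 : ℝ) else 0)))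
    (hff : ∀ (x y : Site 4) (μ ν : Fin 4), M x y (Sum.inl μ) (Sum.inl ν) = deltaZLim (d := 3) (x, μ) (y, ν))
    (hfm : ∀ (x y : Site 4) (μ ν : Fin 4), M x y (Sum.inl μ) (Sum.inr ν) = 0)
    (hmf : ∀ (x y : Site 4) (μ ν : Fin 4), M x y (Sum.inr μ) (Sum.inl ν) = 0)
    (hmm : ∀ (x y : Site 4) (μ ν : Fin 4), M x y (Sum.inr μ) (Sum.inr ν) = 0)
    (hD0 : ∀ μ ν lam κ : Fin 4,
      ∑' xz : Site 4 × Site 4, (S μ 0 xz.1 xz.2 (Sum.inl lam) (Sum.inl ν) + S lam xz.1 0 xz.2 (Sum.inl μ) (Sum.inl ν)) * (xz.1 κ : ℝ) = 0)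
    (hD1 : ∀ μ ν lam κ : Fin 4,
      ∑' xz : Site 4 × Site 4, (S μ 0 xz.1 xz.2 (Sum.inl lam) (Sum.inl ν) + S lam xz.1 0 xz.2 (Sum.inl μ) (Sum.inl ν)) * (xz.2 κ : ℝ) = 0)

include hS hδ hcov hlaw hff hfm hmf hmm hD0 hD1

/-- [our object] **THE CUBIC GERM OF THE PERFECT ACTION JET IS `c·ymGerm`** when its Ward block is the perfect Hessian: S-side letters (a1)(a2)(a4)(a6) of `S`
against `M` with constant `c`, `M_ff = Δ_∞` (other blocks `0`) ⟹ `cubicGermOf S μ ν λ κ i = c·ymGerm μ ν λ κ i` — the five Hessian-side letters of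
`cubicGermOf_eq_smul_ymGerm_of_admissible` are the gen-9 theorems `admissible_symmetry_letters_deltaZLim` (decay, permutation, bond reflection with the shift
table `t α μ ν = [ν = α] − [μ = α]`) and `admissible_column_letters_deltaZLim` (zeroth∕first column moments, and `cQ(c, Δ_∞) = c`). -/
theorem cubicGermOf_of_admissible_deltaZLim (μ ν lam κ : Fin 4) (i : Fin 2) :
    cubicGermOf S μ ν lam κ i = c * ymGerm μ ν lam κ i := by
  obtain ⟨hM, hP, hF⟩ := admissible_symmetry_letters_deltaZLim (M := M) hff hfm hmf hmm
  obtain ⟨hM0, hM1, hcQ⟩ := admissible_column_letters_deltaZLim (M := M) (fun x μ ν => hff x 0 μ ν) c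
  obtain ⟨hG, -⟩ := cubicGermOf_eq_smul_ymGerm_of_admissible hS hδ hcov hlaw hM (kappaZ_pos 3) hM0 hM1 hP
    (fun α μ ν => (if ν = α then (1 : ℤ) else 0) - (if μ = α then 1 else 0)) (fun α x μ ν => hF α x μ ν) hD0 hD1
  rw [hG μ ν lam κ i, hcQ]

/-- [our object] **THE TOTAL GLUON GERM**: `cubicGermOf (S + sliceA 3) μ ν λ κ i = c·ymGerm μ ν λ κ i + sliceGerm μ ν λ κ i` (germ additivity over localised
families + the explicit slice germ `cubicGermOf_sliceA`). -/
theorem cubicGermOf_add_sliceA_of_admissible_deltaZLim (μ ν lam κ : Fin 4) (i : Fin 2) :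
    cubicGermOf (S + sliceA 3) μ ν lam κ i = c * ymGerm μ ν lam κ i + sliceGerm μ ν lam κ i := by
  rw [cubicGermOf_add hS hδ (locStencil_sliceA (d := 3) (le_of_lt one_pos)) one_pos,
    cubicGermOf_of_admissible_deltaZLim hS hδ hcov hlaw hff hfm hmf hmm hD0 hD1, cubicGermOf_sliceA]

omit hS hδ hcov hlaw hff hfm hmf hmm hD0 hD1 in
/-- [our object] **THE END's `hgermV` AT `c = 1`**: if the perfect action's cubic jet obeys the tree Ward law against `Δ_∞` with constant `1` (rows H2V-4′-a∕c) and the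
letters (a1)(a2)(a6), then `cubicGermOf (S + sliceA 3) = (1 : ℝ) • bfGerm` — verbatim the germ hypothesis of `hasym_PiBF_vertex2OfK_of_far_nearPieces` ∕
`hasym_PiBF_vertex2OfK_of_sliceLedger` with `cQ = 1` (so the colour equation reads `(40·wg·¼·c4² − wgh·(−½)·c4²)∕3 = kappaBal N`).  LOCATED: for `c ≠ 1`
the total germ `c·ymGerm + sliceGerm` is not a multiple of `bfGerm = ymGerm + sliceGerm`; the END's socket shape presumes `c = 1`. -/
theorem hgermV_of_admissible_deltaZLim (hS : LocStencil S Cs δ) (hδ : 0 < δ)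
    (hcov : ∀ (lam : Fin 4) (v : Site 4), S lam v = shiftK (-v) (S lam 0))
    (hlaw1 : ∀ (x z : Site 4) (μ ν : Fin 4), divV S 0 x z (Sum.inl μ) (Sum.inl ν) =
      (1 : ℝ) * M x z (Sum.inl μ) (Sum.inl ν) * ((if z = 0 then (1 : ℝ) else 0) - (if x = 0 then (1 : ℝ) else 0)))
    (hff : ∀ (x y : Site 4) (μ ν : Fin 4), M x y (Sum.inl μ) (Sum.inl ν) = deltaZLim (d := 3) (x, μ) (y, ν))
    (hfm : ∀ (x y : Site 4) (μ ν : Fin 4), M x y (Sum.inl μ) (Sum.inr ν) = 0)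
    (hmf : ∀ (x y : Site 4) (μ ν : Fin 4), M x y (Sum.inr μ) (Sum.inl ν) = 0)
    (hmm : ∀ (x y : Site 4) (μ ν : Fin 4), M x y (Sum.inr μ) (Sum.inr ν) = 0)
    (hD0 : ∀ μ ν lam κ : Fin 4,
      ∑' xz : Site 4 × Site 4, (S μ 0 xz.1 xz.2 (Sum.inl lam) (Sum.inl ν) + S lam xz.1 0 xz.2 (Sum.inl μ) (Sum.inl ν)) * (xz.1 κ : ℝ) = 0)
    (hD1 : ∀ μ ν lam κ : Fin 4,
      ∑' xz : Site 4 × Site 4, (S μ 0 xz.1 xz.2 (Sum.inl lam) (Sum.inl ν) + S lam xz.1 0 xz.2 (Sum.inl μ) (Sum.inl ν)) * (xz.2 κ : ℝ) = 0) :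
    cubicGermOf (S + sliceA 3) = (1 : ℝ) • bfGerm := by
  funext μ ν lam κ i
  rw [cubicGermOf_add_sliceA_of_admissible_deltaZLim hS hδ hcov hlaw1 hff hfm hmf hmm hD0 hD1 μ ν lam κ i]
  simp [bfGerm]

end Summit.QuantumFields.BalabanUV.Beta.FP.PerfectVertexGermSocket

/-! ## §3 (v1.1) The remaining V-side letters of the END at `V := S + sliceA 3`: bi-localisation, covariance, zero mass
(re-opened namespace: the §1–§2 section hypotheses are out of scope here) -/

namespace Summit.QuantumFields.BalabanUV.Beta.FP.PerfectVertexGermSocket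

open Literature.MathematicalPhysics.QuantumFieldTheory.Balaban1983to89
open Literature.MathematicalPhysics.QuantumFieldTheory.Balaban1983to89.Beta
open ExpKernelCalculus (Site MKer Decays BiLoc shiftK)
open B12Sec2to5 (l1)
open OneStepResolventKernel (Fib LocStencil)
open KernelWard (divV)
open Summit.QuantumFields.BalabanUV.Beta.GAN24.DirichletExhaustionDeltaZ (kappaZ kappaZ_pos)
open Summit.QuantumFields.BalabanUV.Beta.GAN24.EffectiveLaplacianLimit (deltaZLim)
open Summit.QuantumFields.BalabanUV.Beta.FP.SliceVertex (sliceA locStencil_sliceA sliceA_translate)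
open Summit.QuantumFields.BalabanUV.Beta.FP.PerfectHessianColumnMoments (admissible_column_letters_deltaZLim)
open Summit.QuantumFields.BalabanUV.Beta.FP.PerfectHessianColumnCovariance (admissible_symmetry_letters_deltaZLim)

variable {S : Fin 4 → Site 4 → MKer 4 (Fib 3)} {Cs δ c : ℝ} {M : MKer 4 (Fib 3)}

/-- [our object] **(hV) THE TOTAL GLUON VERTEX IS BI-LOCALISED AT ITS BOND**: `BiLoc ((S + sliceA 3) μ y) y y (Cs + 2·e^{4δ}) δ` from `LocStencil S Cs δ` and
`SliceVertex.locStencil_sliceA` (read at the same rate). -/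
theorem biLoc_add_sliceA (hS : LocStencil S Cs δ) (hδ : 0 ≤ δ) (μ : Fin 4) (y : Site 4) :
    BiLoc ((S + sliceA 3) μ y) y y (Cs + 2 * Real.exp (4 * δ)) δ :=
  KernelWard.biLoc_add (hS μ y) (locStencil_sliceA (d := 3) hδ μ y)

/-- [folklore] two successive shifts compose. -/
theorem shiftK_shiftK (v w : Site 4) (K : MKer 4 (Fib 3)) : shiftK v (shiftK w K) = shiftK (v + w) K := by
  funext x z a b
  simp only [shiftK]
  rw [add_assoc x v w, add_assoc z v w]

/-- [our object] **(hcovV) THE TOTAL GLUON VERTEX IS TRANSLATION-COVARIANT**: `(S + sliceA 3) μ (y + t) = shiftK (−t) ((S + sliceA 3) μ y)` from the base-point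
covariance of `S` and `SliceVertex.sliceA_translate`. -/
theorem cov_add_sliceA (hcov : ∀ (lam : Fin 4) (v : Site 4), S lam v = shiftK (-v) (S lam 0)) (μ : Fin 4) (y t : Site 4) :
    (S + sliceA 3) μ (y + t) = shiftK (-t) ((S + sliceA 3) μ y) := by
  have hS' : S μ (y + t) = shiftK (-t) (S μ y) := by
    rw [hcov μ (y + t), hcov μ y, shiftK_shiftK, neg_add, add_comm]
  have hT : sliceA 3 μ (y + t) = shiftK (-t) (sliceA 3 μ y) := sliceA_translate (d := 3) μ y t
  have hadd : ∀ (A B : MKer 4 (Fib 3)) (v : Site 4), shiftK v (A + B) = shiftK v A + shiftK v B := fun A B v => rfl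
  calc (S + sliceA 3) μ (y + t) = S μ (y + t) + sliceA 3 μ (y + t) := rfl
    _ = shiftK (-t) (S μ y) + shiftK (-t) (sliceA 3 μ y) := by rw [hS', hT]
    _ = shiftK (-t) ((S + sliceA 3) μ y) := by rw [← hadd]; rfl

/-- [our object] **(h0V) THE TOTAL GLUON VERTEX HAS ZERO TOTAL MASS**: `Σ'_{(x,z)} (S + sliceA 3) λ 0 x z (inl α)(inl β) = 0` — for `S` from the tree Ward law
against a decaying `M` with vanishing FIRST column moments (`CubicGermWard.tsum_zeroth_eq_zero_of_col`), for the slice by `SliceCubicGerm.tsum_sliceA_eq_zero`;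
the two series converge separately (`CubicGermPairing.summable_pairOf` at the unit weight). -/
theorem h0V_add_sliceA_of_law (hS : LocStencil S Cs δ) (hδ : 0 < δ)
    (hcov : ∀ (lam : Fin 4) (v : Site 4), S lam v = shiftK (-v) (S lam 0))
    (hlaw : ∀ (x z : Site 4) (μ ν : Fin 4), divV S 0 x z (Sum.inl μ) (Sum.inl ν) =
      c * M x z (Sum.inl μ) (Sum.inl ν) * ((if z = 0 then (1 : ℝ) else 0) - (if x = 0 then (1 : ℝ) else 0)))
    {CM δM : ℝ} (hM : Decays M CM δM) (hδM : 0 < δM)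
    (hM1 : ∀ (μ ν κ : Fin 4), ∑' x : Site 4, M x 0 (Sum.inl μ) (Sum.inl ν) * (x κ : ℝ) = 0)
    (lam α β : Fin 4) :
    ∑' p : Site 4 × Site 4, (S + sliceA 3) lam 0 p.1 p.2 (Sum.inl α) (Sum.inl β) = 0 := by
  have hcr := CubicGermWard.col_row_of_decays (M := M) hM
  have hSz := CubicGermWard.tsum_zeroth_eq_zero_of_col hS hδ hcov hlaw hcr.1 hcr.2 hδM hM1 lam α β
  have hTz := SliceCubicGerm.tsum_sliceA_eq_zero lam α β
  have h1 : ∀ x z : Site 4, |(fun _ _ => (1 : ℝ)) x z| ≤ 1 * ((l1 x + 1) ^ 0 * (l1 z + 1) ^ 0) := fun x z => by simp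
  have sS := CubicGermPairing.summable_pairOf hS hδ (φ := fun _ _ => (1 : ℝ)) zero_le_one h1 lam α β
  have sT := CubicGermPairing.summable_pairOf (locStencil_sliceA (d := 3) (le_of_lt one_pos)) one_pos (φ := fun _ _ => (1 : ℝ)) zero_le_one h1 lam α β
  simp only [mul_one] at sS sT
  have e : (fun p : Site 4 × Site 4 => (S + sliceA 3) lam 0 p.1 p.2 (Sum.inl α) (Sum.inl β))
      = fun p => S lam 0 p.1 p.2 (Sum.inl α) (Sum.inl β) + sliceA 3 lam 0 p.1 p.2 (Sum.inl α) (Sum.inl β) := by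
    funext p; rfl
  rw [e, sS.tsum_add sT, hSz, hTz, add_zero]

/-- [our object] **(h0V) AT THE PERFECT HESSIAN**: with `M_ff = Δ_∞` (other blocks `0`) the column letters are gen-9 theorems, so the END's zero-mass letter needs only
the S-side letters (a1)(a2)(a4). -/
theorem h0V_add_sliceA_of_admissible_deltaZLim (hS : LocStencil S Cs δ) (hδ : 0 < δ)
    (hcov : ∀ (lam : Fin 4) (v : Site 4), S lam v = shiftK (-v) (S lam 0))
    (hlaw : ∀ (x z : Site 4) (μ ν : Fin 4), divV S 0 x z (Sum.inl μ) (Sum.inl ν) =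
      c * M x z (Sum.inl μ) (Sum.inl ν) * ((if z = 0 then (1 : ℝ) else 0) - (if x = 0 then (1 : ℝ) else 0)))
    (hff : ∀ (x y : Site 4) (μ ν : Fin 4), M x y (Sum.inl μ) (Sum.inl ν) = deltaZLim (d := 3) (x, μ) (y, ν))
    (hfm : ∀ (x y : Site 4) (μ ν : Fin 4), M x y (Sum.inl μ) (Sum.inr ν) = 0)
    (hmf : ∀ (x y : Site 4) (μ ν : Fin 4), M x y (Sum.inr μ) (Sum.inl ν) = 0)
    (hmm : ∀ (x y : Site 4) (μ ν : Fin 4), M x y (Sum.inr μ) (Sum.inr ν) = 0)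
    (lam α β : Fin 4) :
    ∑' p : Site 4 × Site 4, (S + sliceA 3) lam 0 p.1 p.2 (Sum.inl α) (Sum.inl β) = 0 := by
  obtain ⟨hM, -, -⟩ := admissible_symmetry_letters_deltaZLim (M := M) hff hfm hmf hmm
  obtain ⟨-, hM1, -⟩ := admissible_column_letters_deltaZLim (M := M) (fun x μ ν => hff x 0 μ ν) c
  exact h0V_add_sliceA_of_law hS hδ hcov hlaw hM (kappaZ_pos 3) hM1 lam α β

end Summit.QuantumFields.BalabanUV.Beta.FP.PerfectVertexGermSocket

end
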